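import Literature.AlgebraicGeometry.Morphisms.CechModuleAffineBasic
import HarnessLib

/-!
# Vanishing of `Ȟ¹(𝒲, M)` for a quasi-coherent module on any family of opens covering an affine open

The module version of `cechH1_affine_vanishing_holds` (`Morphisms/CechH1AffineProofs`): for a scheme
`f : X → Spec A`, an affine-localizing (e.g. QUASI-COHERENT,
`Literature.AlgebraicGeometry.Modules.IsAffineLocalizing.of_isQuasicoherent`) sheaf of `𝒪_X`-modules `M`, an affine open `V ⊆ X` and any family of
opens `(W_j)_j` of `X` with `⋃_j W_j = V`, every Čech `1`-cocycle of `M` on `(W_j)` is a coboundary: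
`Ž¹ ⊆ B̌¹`, i.e. `Ȟ¹((W_j)_j, M) = 0` (Görtz–Wedhorn II, Lemma 22.1: for `X` affine and `𝓕`
quasi-coherent, `Ȟⁱ(X, 𝓕) = 0` for `i > 0`, with Cor. 21.81: `Ȟ¹(𝒲, 𝓕) ↪ Ȟ¹(X, 𝓕)`; Hartshorne III
Thm. 3.5 / Prop. 4.3-type statement in Čech form; The Stacks Project, Tag 01X8). Proof as printed
(Görtz–Wedhorn I, Prop. 12.32): every point of `V` has a principal neighbourhood `D(r) ⊆ W_j`, finitely
many cover the quasi-compact `V`, the cocycle refined to this principal covering is a coboundary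
(`cechMZ1_le_cechMB1_basicOpen`, Lemma 12.33), hence so is the cocycle
(`mem_cechMB1_of_refineMC1_mem_cechMB1`, Cor. 21.81).

* `cechMZ1_le_cechMB1_of_isAffineOpen` — the theorem; `cechMH1_eq_zero_of_isAffineOpen` — class form.

This is the input making `Γ(V, ·)` right exact on short exact sequences with quasi-coherent kernel
for affine `V` (`Morphisms/CechModuleShortExact`). Everything is proved; no named facts. Mathlib
searched (pin v4.32): `IsAffineOpen.exists_basicOpen_le`, `IsAffineOpen.isCompact`,
`IsAffineOpen.iSup_basicOpen_eq_self_iff`, `IsCompact.elim_finite_subcover` (used).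

## References

* U. Görtz, T. Wedhorn, *Algebraic Geometry II: Cohomology of Schemes*, Springer Spektrum (2023),
  doi:10.1007/978-3-658-43031-3: Lemma 22.1, p. 327; Cor. 21.81, p. 265. [GortzWedhorn2023]
* U. Görtz, T. Wedhorn, *Algebraic Geometry I: Schemes*, 2nd ed. (2020): Prop. 12.32 and Lemma 12.33,
  p. 421. [GortzWedhorn2020]
* The Stacks Project, Tag 01X8, Tag 01X9. [StacksProject]
-/

noncomputable section

open CategoryTheory AlgebraicGeometry Limits TopologicalSpace Opposite

universe u v

namespace Literature.AlgebraicGeometry.Morphisms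

variable {A : Type u} [CommRing A] {X : Scheme.{u}} (f : X ⟶ Spec (.of A)) {M : X.Modules}
  (hM : Literature.AlgebraicGeometry.Modules.IsAffineLocalizing M)

include hM

/-- **Vanishing of `Ȟ¹(𝒲, M)` on an affine open for every family `𝒲` covering it** (Görtz–Wedhorn II,
Lemma 22.1 with Cor. 21.81; Görtz–Wedhorn I, Prop. 12.32): for `M` affine-localizing (e.g.
quasi-coherent), `V` affine and opens `W_j ⊆ X` with `⋃_j W_j = V`, every Čech `1`-cocycle of `M` on
`(W_j)_j` is a coboundary. [cite: GortzWedhorn2023, Lemma 22.1 (p. 327) with Cor. 21.81 (p. 265)] -/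
theorem cechMZ1_le_cechMB1_of_isAffineOpen {V : X.Opens} (hV : IsAffineOpen V) {J : Type v}
    (W : J → X.Opens) (hW : ⨆ j, W j = V) : cechMZ1 f M W ≤ cechMB1 f M W := by
  classical
  -- principal neighbourhoods inside the `W_j`
  have hpt : ∀ p : V, ∃ jr : J × Γ(X, V), X.basicOpen jr.2 ≤ W jr.1 ∧ (p : X) ∈ X.basicOpen jr.2 := by
    intro p
    have hp : (p : X) ∈ ⨆ j, W j := by rw [hW]; exact p.2
    obtain ⟨j, hj⟩ := Opens.mem_iSup.mp hp
    obtain ⟨g, hg, hpg⟩ := hV.exists_basicOpen_le ⟨(p : X), hj⟩ p.2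
    exact ⟨(j, g), hg, hpg⟩
  choose jr hjrW hjrp using hpt
  -- finitely many suffice
  obtain ⟨t, ht⟩ := hV.isCompact.elim_finite_subcover
    (fun p : V => (X.basicOpen (jr p).2 : Set X)) (fun p => (X.basicOpen (jr p).2).isOpen)
    (fun q hq => Set.mem_iUnion.mpr ⟨⟨q, hq⟩, hjrp ⟨q, hq⟩⟩)
  let r : ↥t → Γ(X, V) := fun l => (jr l.1).2
  have hcovD : ⨆ l, X.basicOpen (r l) = V := by
    apply le_antisymm (iSup_le fun l => X.basicOpen_le (r l))
    intro q hq
    obtain ⟨p, hp, hpq⟩ := Set.mem_iUnion₂.mp (ht hq)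
    exact Opens.mem_iSup.mpr ⟨⟨p, hp⟩, hpq⟩
  have hspan : Ideal.span (Set.range r) = ⊤ := by
    rw [← hV.iSup_basicOpen_eq_self_iff, iSup_range']
    exact hcovD
  -- reduce to the principal covering
  intro z hz
  refine mem_cechMB1_of_refineMC1_mem_cechMB1 f M W (fun l => X.basicOpen (r l)) (fun l => (jr l.1).1)
    (fun l => hjrW l.1) (fun j => ?_) hz ?_
  · rw [hcovD, ← hW]
    exact le_iSup W j
  · exact cechMZ1_le_cechMB1_basicOpen f hM hV r hspan
      (refineMC1_mem_cechMZ1 f M W (fun l => X.basicOpen (r l)) _ _ hz)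

/-- Class form: `Ȟ¹((W_j)_j, M) = 0` for such families. [folklore] -/
theorem cechMH1_eq_zero_of_isAffineOpen {V : X.Opens} (hV : IsAffineOpen V) {J : Type v}
    (W : J → X.Opens) (hW : ⨆ j, W j = V) (x : CechMH1 f M W) : x = 0 := by
  obtain ⟨z, rfl⟩ := CechMH1.mk_surjective f M W x
  rw [CechMH1.mk_eq_zero_iff]
  exact cechMZ1_le_cechMB1_of_isAffineOpen f hM hV W hW z.2

end Literature.AlgebraicGeometry.Morphisms

end
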